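import Literature.NumberTheory.Automorphic.OddArtinWeightOne
import Literature.NumberTheory.Automorphic.StrongArtinGL2Proofs
import Literature.NumberTheory.GaloisRepresentations.ProjectiveTypeProofs
import HarnessLib

/-!
# Weight-one modularity of odd `ρ : Γ_ℚ → GL₂(ℂ)` (Khare–Wintenberger): proved reductions

Topic `NumberTheory/Automorphic`. Companion to `Automorphic/OddArtinWeightOne`, which states the
named fact `khareWintenberger_weightOne_of_isOdd` (Khare–Wintenberger, Invent. Math. 178 (2009),
Thm. 10.1 (ii) with the remark following its proof, printed p. 18: every continuous irreducible
odd `ρ : Γ_ℚ → GL₂(ℂ)` arises from a weight-one newform; the shape of Theorem A of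
Buzzard–Dickinson–Shepherd-Barron–Taylor, Duke Math. J. 109 (2001), without its local
hypotheses). This file introduces NO definition and NO named fact (D-0026): it PROVES the two
reductions by which that fact is reached on the automorphic side, in the tree's vocabulary of
`Automorphic/StrongArtinGL2` (`IsPiOfArtinRep`, the three solvable cases of the strong Artin
conjecture, Gelbart's Prop. 4.1 and Prop. 4.2), exactly as the tree already assembles the
solvable-image statement `langlands_tunnell ρ` (lang.S30) in `langlands_tunnell_of_strongArtin` /
`langlands_tunnell_of_three_cases`.

* `khareWintenberger_weightOne_of_isOdd_of_strongArtin` — **proved**: if every irreducible odd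
  `σ : Γ_ℚ → GL₂(ℂ)` has a cuspidal `π(σ)` on `GL₂(𝔸_ℚ)` in Tunnell's almost-everywhere sense
  (`IsPiOfArtinRep σ π.1`), then, granting Gelbart's Prop. 4.1
  (`frobSatakeCompatibleAt_of_isPiOfArtinRep`) and the weight-one dictionary Prop. 4.2
  (`exists_isNewform1_of_isPiOfArtinRep`), `khareWintenberger_weightOne_of_isOdd` holds. The proof
  is that of `langlands_tunnell_of_strongArtin` with the solvability hypothesis never used
  (Gelbart 1997, §2.6 and Prop. 4.2: `π(σ)` is of weight one, corresponds to a newform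
  `f ∈ S₁(Γ₁(N))`, and at every `p ∤ N` the Satake parameter of `π` is the pair of roots of the
  Hecke polynomial of `f`, while `σ` is unramified at `p` with `charpoly σ(Frob_p) = ∏ (X − α)`).
* `strongArtin_of_isOdd_of_cases` — **proved**: the strong Artin conjecture (almost-everywhere
  form) for every irreducible odd `σ : Γ_ℚ → GL₂(ℂ)` follows from its dihedral, tetrahedral and
  octahedral cases (the named facts `strongArtin_of_isDihedralType`, `…TetrahedralType`,
  `…OctahedralType` of `StrongArtinGL2`: Jacquet–Langlands §12, Langlands 1980 §3, Tunnell 1981)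
  and its ODD ICOSAHEDRAL case, written out in full as a hypothesis (it is not a declaration of
  `Literature/`; it is the odd half of the summit-side item
  `Summit.Langlands.Langlands.Theses.GaloisWeightedBE.StrongArtinIcosahedralQ`, whose body inlines
  `IsPiOfArtinRep` verbatim). The case split is Klein's classification, here the PROVED theorem
  `klein_finite_subgroup_pgl_two_holds` (`GaloisRepresentations/ProjectiveTypeProofs`) through
  `projectiveType_of_isIrreducible` (an irreducible `σ` with finite image —
  `finite_range_toMonoidHom` — is of dihedral, tetrahedral, octahedral or icosahedral type).
  This is the division of labour of Buzzard–Dickinson–Shepherd-Barron–Taylor 2001, §Introduction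
  (solvable image: Langlands–Tunnell; "the icosahedral case" is what their Theorem A adds) and of
  Calegari, ICM 2022 survey (2023), §4.
* `khareWintenberger_weightOne_of_isOdd_of_icosahedral` — **proved**: the composite; so the
  named fact `khareWintenberger_weightOne_of_isOdd` carries, beyond the debts already counted for
  `langlands_tunnell` (the three solvable cases, Prop. 4.1, Prop. 4.2), exactly ONE further
  input: strong Artin for odd icosahedral `σ` over `ℚ` — in print a theorem
  (Khare–Wintenberger 2009, Thm. 10.1 (ii); earlier under local hypotheses Buzzard–Dickinson–
  Shepherd-Barron–Taylor 2001, Thm. A, and Taylor 2003), not yet a declaration of the tree.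

What is NOT done here. The fact itself is not discharged: its printed proof (Khare–Wintenberger
2009, §10, p. 18: "we conclude from Theorem 1.2, that `ρ̄_λ` for almost all `λ` arise from the
space `S₁(Γ₁(N))` … arguing as in [11], which uses the results of Gross and Coleman–Voloch") is a
corollary of Serre's modularity conjecture — in the tree the unproved named fact
`khare_wintenberger p k` of `Automorphic/SerreConjecture` — together with the companion-form
theorems (Gross 1990; Coleman–Voloch 1992) and the lifting of mod-`ℓ` weight-one Katz forms for
`ℓ ≫ 0` (Edixhoven 1992, §4; Khare 1997), for which the tree has no vocabulary yet; the
automorphic road of this file ends at the odd icosahedral case of the strong Artin conjecture,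
which is the same theorem in another language. Base field `ℚ` only; the EVEN icosahedral case is
open and appears nowhere in this file.

## References

* C. Khare, J.-P. Wintenberger, *Serre's modularity conjecture (I)*, Invent. Math. 178 (2009),
  485–504, Thm. 10.1 (ii) and the remark after its proof (p. 18). [KhareWintenberger2009]
* K. Buzzard, M. Dickinson, N. Shepherd-Barron, R. Taylor, *On icosahedral Artin
  representations*, Duke Math. J. 109 (2001), 283–318, Thm. A and §Introduction. [BuzzardEtAl2001]
* S. Gelbart, *Three lectures on the modularity of `ρ̄_{E,3}` and the Langlands reciprocity
  conjecture*, in: Modular forms and Fermat's last theorem (1997), Lecture I Remark 1.3 (1),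
  Thm. 2.1, §2.6, Prop. 4.1, Prop. 4.2. [Gelbart1997]
* J. Tunnell, *Artin's conjecture for representations of octahedral type*, Bull. AMS 5 (1981),
  173–175. [Tunnell1981]
-/

noncomputable section

open scoped MatrixGroups ModularForm NumberField
open CongruenceSubgroup NumberField IsDedekindDomain

namespace Literature.NumberTheory.Automorphic

open EllipticCurves.ModularForms GaloisRepresentations

/-! ### From the strong Artin conjecture for odd `σ` to weight-one newforms -/

/-- **Weight-one modularity of odd `ρ` from the strong Artin conjecture and the weight-one
dictionary** (Gelbart 1997, §2.6 ((2.6.1)–(2.6.3)) and Prop. 4.2; Khare–Wintenberger 2009, §10,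
remark after Thm. 10.1, p. 18). If every continuous irreducible odd `σ : Γ_ℚ → GL₂(ℂ)` has a
cuspidal automorphic `π` on `GL₂(𝔸_ℚ)` with `π = π(σ)` in Tunnell's almost-everywhere sense
(`IsPiOfArtinRep σ π.1`), then — granting Gelbart's Prop. 4.1
(`frobSatakeCompatibleAt_of_isPiOfArtinRep`: at every place where `π` is unramified, `σ` is
unramified with `charpoly σ(Frob_v) = ∏_{a ∈ t_{π_v}} (X − a)`) and Prop. 4.2
(`exists_isNewform1_of_isPiOfArtinRep`: such a `π` corresponds to a weight-one newform
`f ∈ S₁(Γ₁(N))` whose Hecke polynomial at every `p ∤ N` is `∏_{a ∈ t_{π_p}} (X − a)`) — every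
such `σ` arises from a weight-one newform away from the level
(`IsGaloisRepOfNewform1 f (algebraMap K_f ℂ) {p ∣ N} σ`), i.e. the named fact
`khareWintenberger_weightOne_of_isOdd` holds. Same proof as the tree's
`langlands_tunnell_of_strongArtin`, whose solvability hypothesis is used only to produce `π(σ)`.
[cite: Gelbart1997, §2.6 and Prop. 4.2] [cite: KhareWintenberger2009, §10, remark after Thm. 10.1 (p. 18)] -/
theorem khareWintenberger_weightOne_of_isOdd_of_strongArtin
    (hSA : ∀ σ : GaloisRepresentations.FramedArtinRep ℚ 2, σ.toGaloisRep.IsIrreducible → σ.IsOdd →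
      ∃ (hcpt : isCompact_glFiniteIntegralLevel 2 ℚ) (π : CuspidalAutomorphicRepData 2 ℚ hcpt),
        IsPiOfArtinRep σ π.1)
    (hAE : frobSatakeCompatibleAt_of_isPiOfArtinRep)
    (hW1 : exists_isNewform1_of_isPiOfArtinRep) :
    khareWintenberger_weightOne_of_isOdd := by
  intro ρ hirr hodd
  obtain ⟨hcpt, π, hπ⟩ := hSA ρ hirr hodd
  obtain ⟨N, hN, f, hf, -, hsat⟩ := hW1 hcpt ρ π hirr hodd hπ
  refine ⟨N, hN, f, hf, fun v hv => ?_⟩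
  obtain ⟨α, hα, hpoly⟩ := hsat v hv
  obtain ⟨hur, hchar⟩ := hAE hcpt ρ π hπ v α hα
  exact ⟨hur, hpoly ▸ hchar⟩

/-! ### The case split: only the odd icosahedral case is not Langlands–Tunnell -/

/-- **Strong Artin for odd two-dimensional `σ` over `ℚ` from the three solvable cases and the
odd icosahedral case** (the reduction of Buzzard–Dickinson–Shepherd-Barron–Taylor 2001,
§Introduction — solvable image: Langlands–Tunnell; icosahedral image: their Theorem A — and
Gelbart 1997, Lecture I, Remark 1.3 (1)). Grant the dihedral (Jacquet–Langlands 1970, §12),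
tetrahedral (Langlands 1980, §3) and octahedral (Tunnell 1981) cases of the strong Artin
conjecture (the named facts `strongArtin_of_isDihedralType`, `strongArtin_of_isTetrahedralType`,
`strongArtin_of_isOctahedralType`) and, as the hypothesis `hI` written out in full, its case for
irreducible ODD `σ : Γ_ℚ → GL₂(ℂ)` of icosahedral type (projective image `A₅`; in print a theorem:
Khare–Wintenberger 2009, Thm. 10.1 (ii); it is the odd half of the summit-side item
`StrongArtinIcosahedralQ` and is not a declaration of `Literature/`). Then every continuous
irreducible odd `σ : Γ_ℚ → GL₂(ℂ)` has a cuspidal `π` on `GL₂(𝔸_ℚ)` with `IsPiOfArtinRep σ π.1`: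
`σ` has finite image (`finite_range_toMonoidHom`), so by Klein's classification — the proved
`klein_finite_subgroup_pgl_two_holds`, through `projectiveType_of_isIrreducible`, the cyclic type
being excluded by irreducibility — it is of dihedral, tetrahedral, octahedral or icosahedral
type, and the corresponding case applies. Compare `strongArtin_of_isSolvable_of_cases`.
[cite: BuzzardEtAl2001, §Introduction and Thm. A] [cite: Gelbart1997, Lecture I, Remark 1.3 (1)] -/
theorem strongArtin_of_isOdd_of_cases (hd : strongArtin_of_isDihedralType)
    (ht : strongArtin_of_isTetrahedralType) (ho : strongArtin_of_isOctahedralType)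
    (hI : ∀ σ : GaloisRepresentations.FramedArtinRep ℚ 2, σ.toGaloisRep.IsIrreducible → σ.IsOdd →
      GaloisRepresentations.IsIcosahedralType σ.toMonoidHom →
      ∃ (hcpt : isCompact_glFiniteIntegralLevel 2 ℚ) (π : CuspidalAutomorphicRepData 2 ℚ hcpt),
        IsPiOfArtinRep σ π.1)
    (σ : GaloisRepresentations.FramedArtinRep ℚ 2) (hirr : σ.toGaloisRep.IsIrreducible)
    (hodd : σ.IsOdd) :
    ∃ (hcpt : isCompact_glFiniteIntegralLevel 2 ℚ) (π : CuspidalAutomorphicRepData 2 ℚ hcpt),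
      IsPiOfArtinRep σ π.1 := by
  haveI : Finite σ.toMonoidHom.range := finite_range_toMonoidHom σ
  have hirr' : (GaloisRepresentations.toStdRepresentation σ.toMonoidHom).IsIrreducible :=
    (isIrreducible_toStdRepresentation_iff σ).mpr hirr
  rcases GaloisRepresentations.projectiveType_of_isIrreducible
      GaloisRepresentations.klein_finite_subgroup_pgl_two_holds σ.toMonoidHom hirr' with h | h | h | h
  · exact hd σ hirr h
  · exact ht σ hirr h
  · exact ho σ hirr h
  · exact hI σ hirr hodd h

/-- **`khareWintenberger_weightOne_of_isOdd` from the Langlands–Tunnell cases, the weight-one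
dictionary and the odd icosahedral case of the strong Artin conjecture** (Khare–Wintenberger
2009, §10, remark after Thm. 10.1, p. 18: "Part (ii) implies Artin's conjecture for odd
irreducible 2-dimensional representations of `G_ℚ` … thus we rederive by a different method
Theorem A of [BDST]"; Buzzard–Dickinson–Shepherd-Barron–Taylor 2001, §Introduction; Gelbart 1997,
§2.6 and Prop. 4.2): `strongArtin_of_isOdd_of_cases` followed by
`khareWintenberger_weightOne_of_isOdd_of_strongArtin`. Hence the named fact owes, beyond the
inputs already counted for `langlands_tunnell` (`langlands_tunnell_of_three_cases`), exactly the
hypothesis `hI`. [cite: KhareWintenberger2009, Thm. 10.1 (ii) and remark p. 18]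
[cite: BuzzardEtAl2001, Thm. A] [cite: Gelbart1997, §2.6 and Prop. 4.2] -/
theorem khareWintenberger_weightOne_of_isOdd_of_icosahedral (hd : strongArtin_of_isDihedralType)
    (ht : strongArtin_of_isTetrahedralType) (ho : strongArtin_of_isOctahedralType)
    (hI : ∀ σ : GaloisRepresentations.FramedArtinRep ℚ 2, σ.toGaloisRep.IsIrreducible → σ.IsOdd →
      GaloisRepresentations.IsIcosahedralType σ.toMonoidHom →
      ∃ (hcpt : isCompact_glFiniteIntegralLevel 2 ℚ) (π : CuspidalAutomorphicRepData 2 ℚ hcpt),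
        IsPiOfArtinRep σ π.1)
    (hAE : frobSatakeCompatibleAt_of_isPiOfArtinRep)
    (hW1 : exists_isNewform1_of_isPiOfArtinRep) :
    khareWintenberger_weightOne_of_isOdd :=
  khareWintenberger_weightOne_of_isOdd_of_strongArtin (strongArtin_of_isOdd_of_cases hd ht ho hI)
    hAE hW1

end Literature.NumberTheory.Automorphic

end
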